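import Summits.HodgeConjecture.HodgeConjecture.Theorems.K2E3ParameterPackageUDock               -- ★ p856088 (K2E3-p14): (P-U dock) conventions at a unitary frame `e : G ≃ₜ* ↥U(σ,J)`; brings ★ `K2E3UnitaryCongruenceFrame.mem_comap_congruenceGL_iff`
import Summits.HodgeConjecture.HodgeConjecture.Theorems.K2E3UnitaryLayerCharacterSurjective   -- ★ p856060 (this seat): (S-U) `exists_eigen_param_of_unitary_character_complex`
import Summits.HodgeConjecture.HodgeConjecture.Theorems.K2E3UnitaryLayerConductorDefect        -- ★ p856094 (this seat): conductor-defect twin `exists_eigen_param_of_unitary_character_defect`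
import HarnessLib

/-!
# Crux `H413` — K2-LIT E3 «EllipticInputs», U12-h package (P-U dock, S-column): THE LAYER-CHARACTER BINDER `hS` OF ★ `exists_levelTraceStable_U_regime` AT A UNITARY FRAME —
# every `ℂ`-valued character of `Kf N′ ⧸ Kf N″` of finite order (`N″ + d_S ≤ 2N′`) is `Ch X` with `X ∈ 𝔰_ε`, for `U := U(σ, J) ≤ GL_n(F)`, `e : G ≃ₜ* ↥U`,
# `Kf m := e⁻¹(U ∩ K_m)`, `Ch X a := ψ(tr(X((e a) − 1)))` — docked from ★ (S-U) `exists_eigen_param_of_unitary_character_complex` (exact conductor) and from ★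
# `exists_eigen_param_of_unitary_character_defect` (conductor defect `c₀`, regime `N″ + c₀ + d_S ≤ 2N′`)

Cell `hodgecm-mathlib`, Track B «K2-LIT», crux item `stmt-HodgeConjecture-24833` (h413), line `K2_E3_EllipticInputs`, unit U12 «HC characters», socket U12-h
`sig_K2E3CharLocConstNearRegular` (‹#9L›); seat K2E1b-p08 (g2), K2 bus 2026-09-04T00:3xZ (K2E3-p09 (g2) 00:25:21Z «ED. 2: fold hS», K2E3-p14 (g2) 00:27:16Z «hS target shape = the
hS binder of p856119 verbatim»); `--supports stmt-HodgeConjecture-24833 --as helper`.  THEOREMS ONLY — no `def`, no named fact, no instance, no notation, no `sorry`.  The binder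
is reproduced VERBATIM from ★ p856036 `K2E3LevelTraceStableAtPlaceU.exists_levelTraceStable_U_regime` (`k := ℂ`, `S := 𝔰_ε`, `Ch` pinned by `hCh` as in ★ p856088), with the
floor `m₀S` arbitrary (unused: (S-U) needs only `1 ≤ N′`) and the regime defect `d_S` read from `hdS : (v(⅟2)·max(1,κ′κ))²·|ϖ|^{d_S} ≤ 1` (to be PRODUCED at the place from the
(Dict) heights of `J`, `J⁻¹` and `v(⅟2)`, exactly like `d` in ★ p856119).  HONEST LABEL: HC_CM is proved only modulo the 7 printed citations (2 remaining named inputs: hLiu418 =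
stmt-HodgeConjecture-24832, h413 = stmt-HodgeConjecture-24833) until rung 0 closes; count-neutral.

THE MATHEMATICS [HarishChandra1999, §17 Thm. 17.1; Serre1977, §8.1].  A character `χ : G → ℂ` multiplicative on `Kf N′` with `χ(a)^m = 1` (`m > 0`) there has `‖χ(a)‖ = 1` (Mathlib
`Complex.norm_eq_one_of_pow_eq_one`); transported to `GL_n(F)` as `χ′(g) := χ(e⁻¹ g)` on `U` (and `1` off `U`) it is multiplicative on `U ∩ K_{N′}` and trivial on `U ∩ K_{N″}`, so ★ (S-U)
gives `X ∈ 𝔰_ε` with `χ′ = χ_X` on `U ∩ K_{N′}`; read back at `a ∈ Kf N′` through `e (e⁻¹ (e a)) = e a`.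

## References
* [HarishChandra1999] Harish-Chandra (DeBacker–Sally), *Admissible Invariant Distributions on Reductive p-adic Groups*, ULECT 16 (1999), §17 Thm. 17.1.
* [Serre1977] J.-P. Serre, *Linear Representations of Finite Groups*, GTM 42 (1977), §8.1.
-/

set_option autoImplicit false
-- the mandated namespace repeats `HodgeConjecture.HodgeConjecture`, as in every `Theorems/*.lean` of this sub-problem
set_option linter.dupNamespace false

noncomputable section

open ValuativeRel Matrix Literature.NumberTheory.Automorphic
open Summit.HodgeConjecture.HodgeConjecture.Cruxes.H413 Summit.HodgeConjecture.HodgeConjecture.Cruxes.H413.K2E3UnitaryCongruenceFrame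
open scoped MatrixGroups

namespace Summit.HodgeConjecture.HodgeConjecture.Cruxes.H413.K2E3ParameterPackageUDockS

variable {F : Type*} [Field F] [ValuativeRel F] [TopologicalSpace F] [IsNonarchimedeanLocalField F] [Invertible (2 : F)] {n : ℕ} (σ : F →+* F)
  {J : Matrix (Fin n) (Fin n) F} {G : Type*} [Group G] [TopologicalSpace G] (e : G ≃ₜ* ↥(unitaryGroupOfForm σ J)) {ϖ : F} (ψ : AddChar F Circle)

omit [IsNonarchimedeanLocalField F] [Invertible (2 : F)] in
/-- **TRANSPORT OF A FINITE-ORDER CHARACTER TO `GL_n(F)`**: `χ : G → ℂ` multiplicative on `Kf N′`, trivial on `Kf N″` (`N′ ≤ N″`), of finite order on `Kf N′` ⇒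
`χ′ g := χ(e⁻¹ g)` (`g ∈ U`; `1` otherwise) is multiplicative on `U ∩ K_{N′}`, trivial on `U ∩ K_{N″}`, of modulus `1` on `U ∩ K_{N′}`, and `χ′ (e a) = χ a`.
[cite: Serre1977, §8.1] -/
theorem transport_character {N' N'' : ℕ} (χ : G → ℂ)
    (hmul : ∀ a ∈ (congruenceGL n (valuation F ϖ ^ N')).comap ((unitaryGroupOfForm σ J).subtype.comp e.toMulEquiv.toMonoidHom),
      ∀ b ∈ (congruenceGL n (valuation F ϖ ^ N')).comap ((unitaryGroupOfForm σ J).subtype.comp e.toMulEquiv.toMonoidHom), χ (a * b) = χ a * χ b)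
    (htriv : ∀ a ∈ (congruenceGL n (valuation F ϖ ^ N'')).comap ((unitaryGroupOfForm σ J).subtype.comp e.toMulEquiv.toMonoidHom), χ a = 1)
    (hfin : ∀ a ∈ (congruenceGL n (valuation F ϖ ^ N')).comap ((unitaryGroupOfForm σ J).subtype.comp e.toMulEquiv.toMonoidHom), ∃ m : ℕ, 0 < m ∧ χ a ^ m = 1) :
    ∃ χ' : GL (Fin n) F → ℂ,
      (∀ a ∈ unitaryGroupOfForm σ J, a ∈ congruenceGL n (valuation F ϖ ^ N') → ∀ b ∈ unitaryGroupOfForm σ J, b ∈ congruenceGL n (valuation F ϖ ^ N') →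
          χ' (a * b) = χ' a * χ' b) ∧
      (∀ a ∈ unitaryGroupOfForm σ J, a ∈ congruenceGL n (valuation F ϖ ^ N'') → χ' a = 1) ∧
      (∀ a ∈ unitaryGroupOfForm σ J, a ∈ congruenceGL n (valuation F ϖ ^ N') → ‖χ' a‖ = 1) ∧
      ∀ a : G, χ' (((e a : ↥(unitaryGroupOfForm σ J)) : GL (Fin n) F)) = χ a := by
  classical
  have hmem : ∀ {g : GL (Fin n) F} (hg : g ∈ unitaryGroupOfForm σ J) {γ : ValueGroupWithZero F}, g ∈ congruenceGL n γ →
      e.symm ⟨g, hg⟩ ∈ (congruenceGL n γ).comap ((unitaryGroupOfForm σ J).subtype.comp e.toMulEquiv.toMonoidHom) := fun {g} hg {γ} hgK =>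
    (mem_comap_congruenceGL_iff e _ _).2 (by rw [e.apply_symm_apply]; exact hgK)
  refine ⟨fun g => if h : g ∈ unitaryGroupOfForm σ J then χ (e.symm ⟨g, h⟩) else 1, fun a haU haK b hbU hbK => ?_, fun a haU haK => ?_, fun a haU haK => ?_,
    fun a => ?_⟩
  · simp only [dif_pos haU, dif_pos hbU, dif_pos (Subgroup.mul_mem _ haU hbU)]
    rw [← hmul _ (hmem haU haK) _ (hmem hbU hbK), ← map_mul]; rfl
  · simp only [dif_pos haU]; exact htriv _ (hmem haU haK)
  · simp only [dif_pos haU]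
    obtain ⟨m, hm, hχm⟩ := hfin _ (hmem haU haK)
    exact Complex.norm_eq_one_of_pow_eq_one hχm (Nat.pos_iff_ne_zero.1 hm)
  · simp only [dif_pos (e a).2, Subtype.coe_eta, e.symm_apply_apply]

/-- **`hS` DOCKED (★ p856036∕p856119's shape; exact conductor)**: every `χ : G → ℂ` multiplicative on `Kf N′`, trivial on `Kf N″`, of finite order on `Kf N′`, with `m₀S ≤ N′`,
`1 ≤ N′ ≤ N″`, `N″ + d_S ≤ 2N′`, equals `Ch X` on `Kf N′` for some `X ∈ 𝔰_ε = {X | J⁻¹ (X.map σ)ᵀ J = ε • X}` — ★ (S-U) `exists_eigen_param_of_unitary_character_complex` through `e`.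
[cite: HarishChandra1999, §17 Thm. 17.1] [cite: Serre1977, §8.1] -/
theorem dock_hS (hϖ : IsUniformizingElement ϖ) (hψ : ∀ x : F, valuation F x ≤ 1 → ψ x = 1) (hψ' : ∃ x : F, valuation F x ≤ (valuation F ϖ)⁻¹ ∧ ψ x ≠ 1)
    {ε : F} (hε : ε = 1 ∨ ε = -1) (hanti : ∀ a : F, σ a = ε * a → ψ a = 1) (hσ : ∀ a : F, σ (σ a) = a) (hσv : ∀ a : F, valuation F (σ a) = valuation F a)
    (hJ : (J.map σ)ᵀ = J) (hJu : IsUnit J.det) {κ κ' : ValueGroupWithZero F} (hJb : ValBound κ J) (hJib : ValBound κ' J⁻¹) {dS : ℕ}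
    (hdS : valuation F (⅟(2 : F)) * max 1 (κ' * κ) * (valuation F (⅟(2 : F)) * max 1 (κ' * κ)) * valuation F ϖ ^ dS ≤ 1)
    (Ch : Matrix (Fin n) (Fin n) F → G → ℂ)
    (hCh : ∀ (X : Matrix (Fin n) (Fin n) F) (g : G),
      Ch X g = ((ψ (Matrix.trace (X * ((((e g : ↥(unitaryGroupOfForm σ J)) : GL (Fin n) F) : Matrix (Fin n) (Fin n) F) - 1))) : Circle) : ℂ)) (m₀S : ℕ) :
    ∀ N' N'' : ℕ, m₀S ≤ N' → 1 ≤ N' → N' ≤ N'' → N'' + dS ≤ 2 * N' → ∀ χ : G → ℂ,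
      (∀ a ∈ (congruenceGL n (valuation F ϖ ^ N')).comap ((unitaryGroupOfForm σ J).subtype.comp e.toMulEquiv.toMonoidHom),
        ∀ b ∈ (congruenceGL n (valuation F ϖ ^ N')).comap ((unitaryGroupOfForm σ J).subtype.comp e.toMulEquiv.toMonoidHom), χ (a * b) = χ a * χ b) →
      (∀ a ∈ (congruenceGL n (valuation F ϖ ^ N'')).comap ((unitaryGroupOfForm σ J).subtype.comp e.toMulEquiv.toMonoidHom), χ a = 1) →
      (∀ a ∈ (congruenceGL n (valuation F ϖ ^ N')).comap ((unitaryGroupOfForm σ J).subtype.comp e.toMulEquiv.toMonoidHom), ∃ m : ℕ, 0 < m ∧ χ a ^ m = 1) →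
      ∃ X ∈ {X : Matrix (Fin n) (Fin n) F | J⁻¹ * (X.map σ)ᵀ * J = ε • X},
        ∀ a ∈ (congruenceGL n (valuation F ϖ ^ N')).comap ((unitaryGroupOfForm σ J).subtype.comp e.toMulEquiv.toMonoidHom), χ a = Ch X a := by
  intro N' N'' _ hN' hle h2 χ hmul htriv hfin
  obtain ⟨χ', hmul', htriv', hnorm', hχ'⟩ := transport_character σ e χ hmul htriv hfin
  obtain ⟨X, hXu, -, hX⟩ := K2E3UnitaryLayerCharacterSurjective.exists_eigen_param_of_unitary_character_complex σ hϖ hψ hψ' hε hanti hσ hσv hJ hJu hJb hJib hdS hN' hle h2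
    χ' hmul' htriv' hnorm'
  refine ⟨X, hXu, fun a ha => ?_⟩
  rw [hCh, ← hχ' a]
  exact hX _ (e a).2 ((mem_comap_congruenceGL_iff e _ _).1 ha)

/-- **`hS` DOCKED, conductor defect `c₀`** (★ `exists_eigen_param_of_unitary_character_defect` through `e`): `hψ'c : ∃ x, v x ≤ |ϖ|^{−(c₀+1)} ∧ ψ x ≠ 1` and the regime
`N″ + (c₀ + d_S) ≤ 2N′` — i.e. the `dS` binder of ★ `exists_levelTraceStable_U_regime` is instantiated at `c₀ + d_S`. [cite: HarishChandra1999, §17 Thm. 17.1] [cite: Serre1977, §8.1] -/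
theorem dock_hS_defect (hϖ : IsUniformizingElement ϖ) (hψ : ∀ x : F, valuation F x ≤ 1 → ψ x = 1) {c₀ : ℕ}
    (hψ'c : ∃ x : F, valuation F x ≤ (valuation F ϖ ^ (c₀ + 1))⁻¹ ∧ ψ x ≠ 1)
    {ε : F} (hε : ε = 1 ∨ ε = -1) (hanti : ∀ a : F, σ a = ε * a → ψ a = 1) (hσ : ∀ a : F, σ (σ a) = a) (hσv : ∀ a : F, valuation F (σ a) = valuation F a)
    (hJ : (J.map σ)ᵀ = J) (hJu : IsUnit J.det) {κ κ' : ValueGroupWithZero F} (hJb : ValBound κ J) (hJib : ValBound κ' J⁻¹) {dS : ℕ}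
    (hdS : valuation F (⅟(2 : F)) * max 1 (κ' * κ) * (valuation F (⅟(2 : F)) * max 1 (κ' * κ)) * valuation F ϖ ^ dS ≤ 1)
    (Ch : Matrix (Fin n) (Fin n) F → G → ℂ)
    (hCh : ∀ (X : Matrix (Fin n) (Fin n) F) (g : G),
      Ch X g = ((ψ (Matrix.trace (X * ((((e g : ↥(unitaryGroupOfForm σ J)) : GL (Fin n) F) : Matrix (Fin n) (Fin n) F) - 1))) : Circle) : ℂ)) (m₀S : ℕ) :
    ∀ N' N'' : ℕ, m₀S ≤ N' → 1 ≤ N' → N' ≤ N'' → N'' + (c₀ + dS) ≤ 2 * N' → ∀ χ : G → ℂ,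
      (∀ a ∈ (congruenceGL n (valuation F ϖ ^ N')).comap ((unitaryGroupOfForm σ J).subtype.comp e.toMulEquiv.toMonoidHom),
        ∀ b ∈ (congruenceGL n (valuation F ϖ ^ N')).comap ((unitaryGroupOfForm σ J).subtype.comp e.toMulEquiv.toMonoidHom), χ (a * b) = χ a * χ b) →
      (∀ a ∈ (congruenceGL n (valuation F ϖ ^ N'')).comap ((unitaryGroupOfForm σ J).subtype.comp e.toMulEquiv.toMonoidHom), χ a = 1) →
      (∀ a ∈ (congruenceGL n (valuation F ϖ ^ N')).comap ((unitaryGroupOfForm σ J).subtype.comp e.toMulEquiv.toMonoidHom), ∃ m : ℕ, 0 < m ∧ χ a ^ m = 1) →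
      ∃ X ∈ {X : Matrix (Fin n) (Fin n) F | J⁻¹ * (X.map σ)ᵀ * J = ε • X},
        ∀ a ∈ (congruenceGL n (valuation F ϖ ^ N')).comap ((unitaryGroupOfForm σ J).subtype.comp e.toMulEquiv.toMonoidHom), χ a = Ch X a := by
  classical
  intro N' N'' _ hN' hle h2 χ hmul htriv hfin
  obtain ⟨χ', hmul', htriv', hnorm', hχ'⟩ := transport_character σ e χ hmul htriv hfin
  -- lift `χ'` to the circle on `U ∩ K_{N'}` and apply the defect brick
  let χc : GL (Fin n) F → Circle := fun k =>
    if h : k ∈ unitaryGroupOfForm σ J ∧ k ∈ congruenceGL n (valuation F ϖ ^ N') then ⟨χ' k, mem_sphere_zero_iff_norm.2 (hnorm' k h.1 h.2)⟩ else 1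
  have hχc : ∀ k ∈ unitaryGroupOfForm σ J, k ∈ congruenceGL n (valuation F ϖ ^ N') → ((χc k : Circle) : ℂ) = χ' k := fun k hk hk' => by
    simp only [χc, dif_pos (And.intro hk hk')]
  have hle' : congruenceGL n (valuation F ϖ ^ N'') ≤ congruenceGL n (valuation F ϖ ^ N') := congruenceGL_mono (pow_le_pow_right_of_le_one' hϖ.valuation_le_one hle)
  obtain ⟨X, hXu, -, hX⟩ := K2E3UnitaryLayerConductorDefect.exists_eigen_param_of_unitary_character_defect σ hϖ hψ hψ'c hε hanti hσ hσv hJ hJu hJb hJib hdS hN' hle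
    (by omega) χc
    (fun a haU haK b hbU hbK => Circle.ext (by
      rw [Circle.coe_mul, hχc a haU haK, hχc b hbU hbK, hχc (a * b) (Subgroup.mul_mem _ haU hbU) (Subgroup.mul_mem _ haK hbK)]
      exact hmul' a haU haK b hbU hbK))
    (fun a haU haK => Circle.ext (by rw [hχc a haU (hle' haK), Circle.coe_one]; exact htriv' a haU haK))
  refine ⟨X, hXu, fun a ha => ?_⟩
  have haK := (mem_comap_congruenceGL_iff e _ _).1 ha
  rw [hCh, ← hχ' a, ← hχc _ (e a).2 haK, hX _ (e a).2 haK]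

end Summit.HodgeConjecture.HodgeConjecture.Cruxes.H413.K2E3ParameterPackageUDockS

end
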